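import Literature.MathematicalPhysics.QuantumLattice.GrassmannCumulantSpeciesGradedPrescribedDB
import Literature.MathematicalPhysics.QuantumLattice.GrassmannCumulantPolarisedGradedDB
import HarnessLib

/-!
# The POLARISED GRADED cumulant bound with PRESCRIBED output legs, TELESCOPED: one slot carries the difference profile, the others the
# COMMON majorant, the graded terms averaged over the landing profiles (determinant-bounded covariances)

Topic `MathematicalPhysics/QuantumLattice`; the label-restricted twin of `GrassmannCumulantPolarisedGradedDB` (plain pinned norms) on the LEVELS
(prescribed-legs) track of `GrassmannEffectiveActionGradedTruncationPrescribedDB`.  The telescoping at the replica level is the same —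
`𝓔ᵀ_C(V; n) − 𝓔ᵀ_C(V′; n) = Σ_a 𝓔ᵀ_C(V′,…,V′, V − V′, V,…,V)` by the slot additivity `GrassmannCumulantPolarisedGradedDB.ursellOf_convMoment_update_add`
(Ruelle 1969 §4.4.2; Benfatto–Giuliani–Mastropietro 2006, (2.31)) — and every mixed term is bounded by the prescribed-legs one-assignment bound of
`GrassmannCumulantSpeciesGradedPrescribedDB` (BGM 2006 (2.13)–(2.14), (2.77)–(2.80), Lemma 2.6) with the two-parameter profiles `ν(m', F)` (difference)
in the odd slot and `μ(m', F)` (common majorant of `V`, `V′`) in the others: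

* **`sum_norm_kernel_cumulantOf_sub_le_graded_prescribed_of_gramBounded`** — for `V = Σ_{m' ∈ degs} Σ_Y K ψ`, `V′ = Σ Σ K′ ψ` whose kernels have
  anchored `L¹` norms with `F` further legs constrained to the prescribed predicates at most `μ(m', F)`, and `K − K′` at most `ν(m', F)`, one output
  label pinned, the output labels of the slots `j ∈ J` constrained to `A j`, the others summed:
  `Σ_W ‖kernel_r (𝓔ᵀ_C(V; n) − 𝓔ᵀ_C(V′; n))(W)‖ ≤ n!·κ^{-r}κ^{-2(n−1)}α^{n−1}eⁿ ·
     Σ_{δ ∈ degs^n : r + 2(n−1) ≤ Σ 2δ_a} Σ_φ w_φ Σ_a (e³κ)^{2δ_a} ν(δ_a, |φ⁻¹ a|) · Π_{b ≠ a} (e³κ)^{2δ_b} μ(δ_b, |φ⁻¹ b|)`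
  (`w_φ = ∏_{j∈J} 2δ_{φ j}/N_δ^{|J|}`, `Σ_φ w_φ = 1`).

The consumer is the prescribed-legs graded Lipschitz step `GrassmannEffectiveActionGradedLipschitzPrescribedDB` (cell gate-hubbard-kl, K3 engine child
stub (e) rows C1/C2: the DIFFERENCE tower of «(e)-C ⇐ (b)-TWOVOL» closes on the levels track with the same majorants as the one-volume tower).
Everything is proved; no definition, no named fact.

## Sources

G. Benfatto, A. Giuliani, V. Mastropietro, Ann. Henri Poincaré 7 (2006) 809–898, (2.13)–(2.14), (2.31), (2.77)–(2.80), §2.4 Lemma 2.6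
[`BenfattoGiulianiMastropietro2006`]; K. Gawȩdzki, A. Kupiainen, Comm. Math. Phys. 102 (1985) 1–30, §3 [`GawedzkiKupiainen1985GrossNeveu`];
D. Ruelle, *Statistical Mechanics: Rigorous Results* (1969), §4.4.2 [`Ruelle1969`].
-/

noncomputable section

namespace Literature.MathematicalPhysics.QuantumLattice

open GrassmannAlgebra Finset Literature.Probability.LatticeModels
open scoped InnerProductSpace Nat

universe u

/-! ### Kernel vertices are additive in the kernel (local copies) -/

section KernelAdditive

variable (R : Type*) [CommRing R] {Γ : Type*} [Fintype Γ] [DecidableEq Γ] {n : ℕ}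

/-- A kernel vertex whose kernel at the slot `v` is a sum is the sum of the kernel vertices. [folklore] -/
private theorem kernelVertex_eq_add_of_eq_add' {deg : Fin n → ℕ} (hm : ∀ v, Even (deg v)) (K K₁ K₂ : ∀ v : Fin n, (Fin (deg v) → Γ) → R)
    (v : Fin n) (h : ∀ Y, K v Y = K₁ v Y + K₂ v Y) :
    kernelVertex R hm K v = kernelVertex R hm K₁ v + kernelVertex R hm K₂ v := by
  simp only [kernelVertex, h, add_smul, sum_add_distrib]

/-- A kernel vertex depends on its own kernel only. [folklore] -/
private theorem kernelVertex_congr_slot' {deg : Fin n → ℕ} (hm : ∀ v, Even (deg v)) (K K' : ∀ v : Fin n, (Fin (deg v) → Γ) → R)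
    (v : Fin n) (h : K v = K' v) : kernelVertex R hm K v = kernelVertex R hm K' v := by
  simp only [kernelVertex, h]

omit [Fintype Γ] [DecidableEq Γ] in
/-- Replica kernels are additive in the kernel: the replica of `K` is the replica of `K′` plus the replica of `K − K′`. [folklore] -/
private theorem replicaKer_eq_add_sub' {m : ℕ} (K K' : (Fin m → Γ) → R) (a : Fin n) (Y' : Fin m → Fin n × Γ) :
    replicaKer R K a Y' = replicaKer R K' a Y' + replicaKer R (fun Y => K Y - K' Y) a Y' := by
  simp only [replicaKer]
  split_ifs <;> ring

end KernelAdditive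

/-! ### The polarised graded cumulant bound with prescribed legs -/

section Polarised

variable {𝕜 : Type*} [RCLike 𝕜] {Γ : Type u} [Fintype Γ] [DecidableEq Γ] {n : ℕ} (C : Matrix Γ Γ 𝕜)

omit [Fintype Γ] [DecidableEq Γ] in
/-- Kernels of a difference. [folklore] -/
private theorem kernel_sub_eq' (A B : GrassmannAlgebra 𝕜 Γ) (m : ℕ) (X : Fin m → Γ) :
    kernel 𝕜 (A - B) m X = kernel 𝕜 A m X - kernel 𝕜 B m X := by
  rw [sub_eq_add_neg, kernel_add, ← neg_one_smul 𝕜 B, kernel_smul, neg_one_mul, ← sub_eq_add_neg]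

/-- **The POLARISED GRADED cumulant bound with PRESCRIBED output legs** (BGM 2006 (2.13)–(2.14) with (2.77)–(2.80) and Lemma 2.6, telescoped form):
even elements `V = Σ_{m' ∈ degs} Σ_Y K(m',Y) ψ(Y)`, `V′ = Σ Σ K′ ψ` whose kernels have anchored `L¹` norms with `F` further legs constrained to the
prescribed predicates at most a COMMON majorant `μ(m', F)`, the difference `K − K′` at most `ν(m', F)`; a charged covariance replica-Gram-bounded with
constant `κ > 0`, one-copy row and column sums `≤ α`; one output label pinned, the output labels of the slots `j ∈ J` constrained to `A j`, the others
summed: `Σ_W ‖kernel_r (𝓔ᵀ_C(V; n) − 𝓔ᵀ_C(V′; n))(W)‖ ≤ n!·κ^{-r}κ^{-2(n−1)}α^{n−1}eⁿ ·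
Σ_{δ : r + 2(n−1) ≤ Σ 2δ_a} Σ_φ w_φ Σ_a (e³κ)^{2δ_a} ν(δ_a, |φ⁻¹ a|)·Π_{b ≠ a} (e³κ)^{2δ_b} μ(δ_b, |φ⁻¹ b|)` — by the telescoping
`𝓔ᵀ(V;n) − 𝓔ᵀ(V′;n) = Σ_a 𝓔ᵀ(V′,…,V′, V−V′, V,…,V)` at the replica level and the prescribed one-assignment bound with slot-dependent profiles.
[cite: BenfattoGiulianiMastropietro2006, (2.13)-(2.14), (2.77)-(2.80) and Lemma 2.6] -/
theorem sum_norm_kernel_cumulantOf_sub_le_graded_prescribed_of_gramBounded {κ : ℝ} (hκ : 0 < κ) (hGB : IsGramBoundedR C κ)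
    (degs : Finset ℕ) (K K' : (m' : ℕ) → (Fin (2 * m') → Γ) → 𝕜) {r : ℕ} (J : Finset (Fin r)) (A : Fin r → Γ → Bool)
    (μ ν : ℕ → ℕ → ℝ) (hμ0 : ∀ m' F, 0 ≤ μ m' F) (hν0 : ∀ m' F, 0 ≤ ν m' F)
    (hK : ∀ (m' : ℕ) (T : Finset (Fin r)), T ⊆ J → ∀ (ι : T → Fin (2 * m')), Function.Injective ι →
      ∀ (t : Fin (2 * m')), (∀ j, ι j ≠ t) → ∀ a : Γ,
        ∑ Y ∈ univ.filter (fun Y : Fin (2 * m') → Γ => Y t = a),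
          ‖K m' Y‖ * ∏ j : T, (if A j (Y (ι j)) = true then (1 : ℝ) else 0) ≤ μ m' T.card)
    (hK' : ∀ (m' : ℕ) (T : Finset (Fin r)), T ⊆ J → ∀ (ι : T → Fin (2 * m')), Function.Injective ι →
      ∀ (t : Fin (2 * m')), (∀ j, ι j ≠ t) → ∀ a : Γ,
        ∑ Y ∈ univ.filter (fun Y : Fin (2 * m') → Γ => Y t = a),
          ‖K' m' Y‖ * ∏ j : T, (if A j (Y (ι j)) = true then (1 : ℝ) else 0) ≤ μ m' T.card)
    (hD : ∀ (m' : ℕ) (T : Finset (Fin r)), T ⊆ J → ∀ (ι : T → Fin (2 * m')), Function.Injective ι →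
      ∀ (t : Fin (2 * m')), (∀ j, ι j ≠ t) → ∀ a : Γ,
        ∑ Y ∈ univ.filter (fun Y : Fin (2 * m') → Γ => Y t = a),
          ‖K m' Y - K' m' Y‖ * ∏ j : T, (if A j (Y (ι j)) = true then (1 : ℝ) else 0) ≤ ν m' T.card)
    {α : ℝ} (hα : 0 < α) (hrow : ∀ X, ∑ Y, ‖C X Y‖ ≤ α) (hcol : ∀ Y, ∑ X, ‖C X Y‖ ≤ α)
    (hn : 0 < n) (i : Fin r) (hi : i ∉ J) (w : Γ) :
    ∑ W ∈ univ.filter (fun W : Fin r → Γ => W i = w ∧ ∀ j ∈ J, A j (W j) = true),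
        ‖kernel 𝕜 ((cumulantOf (fun k => evenGaussConv 𝕜 C (vertexOf 𝕜 degs K ^ k)) n : evenPart 𝕜 Γ) : GrassmannAlgebra 𝕜 Γ) r W -
          kernel 𝕜 ((cumulantOf (fun k => evenGaussConv 𝕜 C (vertexOf 𝕜 degs K' ^ k)) n : evenPart 𝕜 Γ) : GrassmannAlgebra 𝕜 Γ) r W‖ ≤
      (n ! : ℝ) * (κ⁻¹ ^ r * κ⁻¹ ^ (2 * (n - 1)) * (α ^ (n - 1) * Real.exp n)) *
        ∑ δ ∈ (Fintype.piFinset fun _ : Fin n => degs) with r + 2 * (n - 1) ≤ ∑ a, 2 * δ a,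
          ∑ pf : J → Fin n, ((∏ j, ((2 * δ (pf j) : ℕ) : ℝ)) / ((∑ a, 2 * δ a : ℕ) : ℝ) ^ J.card) *
            ∑ a, (Real.exp 3 * κ) ^ (2 * δ a) * ν (δ a) (univ.filter fun j : J => pf j = a).card *
              ∏ b ∈ univ.erase a, (Real.exp 3 * κ) ^ (2 * δ b) * μ (δ b) (univ.filter fun j : J => pf j = b).card := by
  set C' : Matrix (Fin n × Γ) (Fin n × Γ) 𝕜 := C.submatrix Prod.snd Prod.snd with hC'
  have huniv : (univ : Finset (Fin n)).Nonempty := ⟨⟨0, hn⟩, mem_univ _⟩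
  -- three species of kernels: `0 ↦ K′`, `1 ↦ K − K′` (the difference), `2 ↦ K`; profiles `ν` for species `1`, `μ` otherwise
  set D : (m' : ℕ) → (Fin (2 * m') → Γ) → 𝕜 := fun m' Y => K m' Y - K' m' Y with hDdef
  set Ksp : Fin 3 → (m' : ℕ) → (Fin (2 * m') → Γ) → 𝕜 := fun s => if s = 1 then D else if s = 0 then K' else K with hKsp
  set Nsp : Fin 3 → ℕ → ℕ → ℝ := fun s => if s = 1 then ν else μ with hNsp
  have hNsp0 : ∀ s m' F, 0 ≤ Nsp s m' F := by
    intro s m' F; simp only [hNsp]; split_ifs; exacts [hν0 m' F, hμ0 m' F]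
  have hNspB : ∀ (s : Fin 3) (m' : ℕ) (T : Finset (Fin r)), T ⊆ J → ∀ (ι : T → Fin (2 * m')), Function.Injective ι →
      ∀ (t : Fin (2 * m')), (∀ j, ι j ≠ t) → ∀ a : Γ,
        ∑ Y ∈ univ.filter (fun Y : Fin (2 * m') → Γ => Y t = a),
          ‖Ksp s m' Y‖ * ∏ j : T, (if A j (Y (ι j)) = true then (1 : ℝ) else 0) ≤ Nsp s m' T.card := by
    intro s m' T hT ι hι t ht a
    simp only [hKsp, hNsp]
    split_ifs with h1 h0
    · exact hD m' T hT ι hι t ht a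
    · exact hK' m' T hT ι hι t ht a
    · exact hK m' T hT ι hι t ht a
  -- the replica families indexed by species-and-degree assignments
  set U : (Fin n → Fin 3 × ℕ) → evenPart 𝕜 (Fin n × Γ) := fun η => ursellOf (convMoment 𝕜 C'
    (kernelVertex 𝕜 (deg := fun b : Fin n => 2 * (η b).2) (fun b => even_two_mul (η b).2)
      fun b => replicaKer 𝕜 (Ksp (η b).1 (η b).2) b)) univ with hU
  -- (1) the prescribed bound per assignment (species-graded layer), as an `if` on the leg constraint
  set c : ℝ := κ⁻¹ ^ r * κ⁻¹ ^ (2 * (n - 1)) * (((n - 1)! : ℝ) * α ^ (n - 1) * Real.exp n) with hc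
  set G : (Fin n → Fin 3 × ℕ) → ℝ := fun η =>
    ∑ pf : J → Fin n, ((∏ j, ((2 * (η (pf j)).2 : ℕ) : ℝ)) / ((∑ a, 2 * (η a).2 : ℕ) : ℝ) ^ J.card) *
      ∏ a, (Real.exp 3 * κ) ^ (2 * (η a).2) * Nsp (η a).1 (η a).2 (univ.filter fun j : J => pf j = a).card with hG
  have hηB : ∀ η : Fin n → Fin 3 × ℕ, ∑ W ∈ univ.filter (fun W : Fin r → Γ => W i = w ∧ ∀ j ∈ J, A j (W j) = true),
      ‖kernel 𝕜 (collapse 𝕜 (Prod.snd : Fin n × Γ → Γ) (U η : GrassmannAlgebra 𝕜 (Fin n × Γ))) r W‖ ≤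
        if r + 2 * (n - 1) ≤ ∑ a, 2 * (η a).2 then (n : ℝ) * (c * G η) else 0 := by
    intro η
    have h := sum_filter_norm_kernel_collapse_speciesReplica_le_prescribed C hκ hGB Ksp J A Nsp hNsp0 hNspB hα hrow hcol hn i hi w η
    rw [hU, hc, hG]
    exact h
  -- (2) the one-species families collapse to the cumulants of `V` and `V′`
  have hcumSp : ∀ s : Fin 3, ((cumulantOf (fun k => evenGaussConv 𝕜 C (vertexOf 𝕜 degs (Ksp s) ^ k)) n : evenPart 𝕜 Γ) :
      GrassmannAlgebra 𝕜 Γ) = ∑ δ ∈ Fintype.piFinset (fun _ : Fin n => degs),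
        collapse 𝕜 (Prod.snd : Fin n × Γ → Γ) (U (fun a => (s, δ a)) : GrassmannAlgebra 𝕜 (Fin n × Γ)) := by
    intro s
    have h1 := collapseEven_ursellOf_convMoment_eq_cumulantOf 𝕜 (Prod.snd : Fin n × Γ → Γ) C (replicaVertex 𝕜 degs (Ksp s))
      (vertexOf 𝕜 degs (Ksp s)) (collapseEven_replicaVertex 𝕜 degs (Ksp s)) huniv
    rw [card_univ, Fintype.card_fin] at h1
    rw [← h1, coe_collapseEven]
    have h2 : ursellOf (convMoment 𝕜 C' (replicaVertex 𝕜 degs (Ksp s))) univ =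
        ∑ δ ∈ Fintype.piFinset (fun _ : Fin n => degs), U (fun a => (s, δ a)) :=
      ursellOf_convMoment_eq_sum_piFinset 𝕜 C' (Prod.fst : Fin n × Γ → Fin n) (fun _ : Fin n => degs)
        (fun a m' => kernelVertex 𝕜 (deg := fun _ : Fin n => 2 * m') (fun _ => even_two_mul m') (fun b => replicaKer 𝕜 (Ksp s m') b) a)
        (fun a m' => coe_kernelVertex_replicaKer_mem 𝕜 m' (Ksp s m') a) ⟨0, hn⟩
    rw [← hC', h2, AddSubmonoidClass.coe_finsetSum, map_sum]
  have hKsp2 : Ksp 2 = K := by rw [hKsp]; dsimp only; rw [if_neg (by decide), if_neg (by decide)]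
  have hKsp0 : Ksp 0 = K' := by rw [hKsp]; dsimp only; rw [if_neg (by decide), if_pos rfl]
  have hKsp1 : Ksp 1 = D := by rw [hKsp]; dsimp only; rw [if_pos rfl]
  -- (3) TELESCOPING at fixed degrees: species maps `fam j` (`V′` below `j`, `V` from `j` on) and `mix a` (`V′` below `a`, the difference at `a`,
  -- `V` above `a`)
  set fam : ℕ → Fin n → Fin 3 := fun j b => if (b : ℕ) < j then 0 else 2 with hfam
  set mix : Fin n → Fin n → Fin 3 := fun a b => if b = a then 1 else if b < a then 0 else 2 with hmix
  have htel : ∀ δ : Fin n → ℕ, U (fun b => ((2 : Fin 3), δ b)) - U (fun b => ((0 : Fin 3), δ b)) = ∑ a, U (fun b => (mix a b, δ b)) := by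
    intro δ
    set Mv : (Fin n → Fin 3) → Fin n → evenPart 𝕜 (Fin n × Γ) := fun s =>
      kernelVertex 𝕜 (deg := fun b : Fin n => 2 * δ b) (fun b => even_two_mul (δ b)) fun b => replicaKer 𝕜 (Ksp (s b) (δ b)) b with hMv
    have hUs : ∀ s : Fin n → Fin 3, U (fun b => (s b, δ b)) = ursellOf (convMoment 𝕜 C' (Mv s)) univ := fun s => rfl
    have hfam0 : (fun b => ((2 : Fin 3), δ b)) = fun b => (fam 0 b, δ b) := by
      funext b; rw [hfam]; dsimp only; rw [if_neg (Nat.not_lt_zero _)]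
    have hfamn : (fun b => ((0 : Fin 3), δ b)) = fun b => (fam n b, δ b) := by
      funext b; rw [hfam]; dsimp only; rw [if_pos b.2]
    rw [hfam0, hfamn, hUs, hUs]
    have hstep : ∀ a : Fin n, ursellOf (convMoment 𝕜 C' (Mv (fam a))) univ - ursellOf (convMoment 𝕜 C' (Mv (fam (a + 1)))) univ =
        ursellOf (convMoment 𝕜 C' (Mv (mix a))) univ := by
      intro a
      have hoff : ∀ (s : Fin n → Fin 3), (∀ b, b ≠ a → s b = mix a b) → Mv s = Function.update (Mv (mix a)) a (Mv s a) := by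
        intro s hs
        funext b
        by_cases hb : b = a
        · subst hb; rw [Function.update_self]
        · rw [Function.update_of_ne hb, hMv]
          exact kernelVertex_congr_slot' 𝕜 (fun b => even_two_mul (δ b)) _ _ b (by simp only [hs b hb])
      have hfa : ∀ b, b ≠ a → fam a b = mix a b := by
        intro b hb
        rw [hfam, hmix]; dsimp only
        rw [if_neg hb]
        by_cases hlt : b < a
        · rw [if_pos (Fin.lt_def.1 hlt), if_pos hlt]
        · rw [if_neg (fun h => hlt (Fin.lt_def.2 h)), if_neg hlt]
      have hfa1 : ∀ b, b ≠ a → fam (a + 1) b = mix a b := by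
        intro b hb
        rw [hfam, hmix]; dsimp only
        rw [if_neg hb]
        have hne : (b : ℕ) ≠ a := fun h => hb (Fin.ext h)
        by_cases hlt : b < a
        · rw [if_pos (by have := Fin.lt_def.1 hlt; omega), if_pos hlt]
        · rw [if_neg (by have : ¬ (b : ℕ) < a := fun h => hlt (Fin.lt_def.2 h); omega), if_neg hlt]
      have hva : Mv (fam a) a = Mv (fam (a + 1)) a + Mv (mix a) a := by
        rw [hMv]
        refine kernelVertex_eq_add_of_eq_add' 𝕜 (fun b => even_two_mul (δ b)) _ _ _ a fun Y => ?_
        have h2 : fam a a = 2 := by simp [hfam]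
        have h0 : fam (a + 1) a = 0 := by simp [hfam]
        have h1 : mix a a = 1 := by simp [hmix]
        simp only [h2, h0, h1, hKsp2, hKsp0, hKsp1, hDdef]
        exact replicaKer_eq_add_sub' 𝕜 (K (δ a)) (K' (δ a)) a Y
      rw [hoff (fam a) hfa, hoff (fam (a + 1)) hfa1, hva, ursellOf_convMoment_update_add, add_sub_cancel_left,
        ← hoff (mix a) fun b _ => rfl]
    have hsum := Finset.sum_range_sub' (fun j => ursellOf (convMoment 𝕜 C' (Mv (fam j))) univ) n
    rw [← hsum, ← Fin.sum_univ_eq_sum_range]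
    exact sum_congr rfl fun a _ => hstep a
  -- (4) the difference of the cumulants as the sum over the odd slot and the degrees of the mixed families
  have hdiff : ∀ W : Fin r → Γ,
      kernel 𝕜 ((cumulantOf (fun k => evenGaussConv 𝕜 C (vertexOf 𝕜 degs K ^ k)) n : evenPart 𝕜 Γ) : GrassmannAlgebra 𝕜 Γ) r W -
        kernel 𝕜 ((cumulantOf (fun k => evenGaussConv 𝕜 C (vertexOf 𝕜 degs K' ^ k)) n : evenPart 𝕜 Γ) : GrassmannAlgebra 𝕜 Γ) r W =
      ∑ a, ∑ δ ∈ Fintype.piFinset (fun _ : Fin n => degs),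
        kernel 𝕜 (collapse 𝕜 (Prod.snd : Fin n × Γ → Γ) (U (fun b => (mix a b, δ b)) : GrassmannAlgebra 𝕜 (Fin n × Γ))) r W := by
    intro W
    have hK2 := hcumSp 2
    have hK0 := hcumSp 0
    rw [hKsp2] at hK2
    rw [hKsp0] at hK0
    rw [hK2, hK0, ← kernel_sub_eq', ← sum_sub_distrib, kernel_sum]
    conv_rhs => rw [sum_comm]
    refine sum_congr rfl fun δ _ => ?_
    rw [← map_sub, ← AddSubgroupClass.coe_sub, htel δ, AddSubmonoidClass.coe_finsetSum, map_sum, kernel_sum]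
  -- (5) the weights of a mixed family: the odd slot carries `ν`, the others `μ`
  have hGmix : ∀ (a : Fin n) (δ : Fin n → ℕ), G (fun b => (mix a b, δ b)) =
      ∑ pf : J → Fin n, ((∏ j, ((2 * δ (pf j) : ℕ) : ℝ)) / ((∑ a, 2 * δ a : ℕ) : ℝ) ^ J.card) *
        ((Real.exp 3 * κ) ^ (2 * δ a) * ν (δ a) (univ.filter fun j : J => pf j = a).card *
          ∏ b ∈ univ.erase a, (Real.exp 3 * κ) ^ (2 * δ b) * μ (δ b) (univ.filter fun j : J => pf j = b).card) := by
    intro a δ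
    rw [hG]
    dsimp only
    refine sum_congr rfl fun pf _ => ?_
    congr 1
    rw [← mul_prod_erase univ (fun b => (Real.exp 3 * κ) ^ (2 * δ b) * Nsp (mix a b) (δ b) (univ.filter fun j : J => pf j = b).card)
      (mem_univ a)]
    have ha : mix a a = 1 := by rw [hmix]; dsimp only; rw [if_pos rfl]
    congr 1
    · rw [hNsp]; dsimp only; rw [ha, if_pos rfl]
    · refine prod_congr rfl fun b hb => ?_
      have hb' : mix a b ≠ 1 := by
        rw [hmix]; dsimp only; rw [if_neg (ne_of_mem_erase hb)]; split_ifs <;> decide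
      rw [hNsp]; dsimp only; rw [if_neg hb']
  -- (6) assemble
  set Δs : Finset (Fin n → ℕ) := (Fintype.piFinset fun _ : Fin n => degs) with hΔs
  set Wset := univ.filter (fun W : Fin r → Γ => W i = w ∧ ∀ j ∈ J, A j (W j) = true) with hWset
  calc ∑ W ∈ Wset,
        ‖kernel 𝕜 ((cumulantOf (fun k => evenGaussConv 𝕜 C (vertexOf 𝕜 degs K ^ k)) n : evenPart 𝕜 Γ) : GrassmannAlgebra 𝕜 Γ) r W -
          kernel 𝕜 ((cumulantOf (fun k => evenGaussConv 𝕜 C (vertexOf 𝕜 degs K' ^ k)) n : evenPart 𝕜 Γ) : GrassmannAlgebra 𝕜 Γ) r W‖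
      = ∑ W ∈ Wset, ‖∑ a, ∑ δ ∈ Δs,
          kernel 𝕜 (collapse 𝕜 (Prod.snd : Fin n × Γ → Γ) (U (fun b => (mix a b, δ b)) : GrassmannAlgebra 𝕜 (Fin n × Γ))) r W‖ :=
        sum_congr rfl fun W _ => by rw [hdiff W]
    _ ≤ ∑ W ∈ Wset, ∑ a, ∑ δ ∈ Δs,
          ‖kernel 𝕜 (collapse 𝕜 (Prod.snd : Fin n × Γ → Γ) (U (fun b => (mix a b, δ b)) : GrassmannAlgebra 𝕜 (Fin n × Γ))) r W‖ :=
        sum_le_sum fun W _ => (norm_sum_le _ _).trans (sum_le_sum fun a _ => norm_sum_le _ _)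
    _ = ∑ a, ∑ δ ∈ Δs, ∑ W ∈ Wset,
          ‖kernel 𝕜 (collapse 𝕜 (Prod.snd : Fin n × Γ → Γ) (U (fun b => (mix a b, δ b)) : GrassmannAlgebra 𝕜 (Fin n × Γ))) r W‖ := by
        rw [sum_comm]; exact sum_congr rfl fun a _ => sum_comm
    _ ≤ ∑ a, ∑ δ ∈ Δs, if r + 2 * (n - 1) ≤ ∑ b, 2 * δ b then (n : ℝ) * (c * G (fun b => (mix a b, δ b))) else 0 :=
        sum_le_sum fun a _ => sum_le_sum fun δ _ => hηB (fun b => (mix a b, δ b))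
    _ = ∑ a, ∑ δ ∈ Δs with r + 2 * (n - 1) ≤ ∑ b, 2 * δ b, (n : ℝ) * (c * G (fun b => (mix a b, δ b))) :=
        sum_congr rfl fun a _ => (sum_filter _ _).symm
    _ = (n : ℝ) * c * ∑ δ ∈ Δs with r + 2 * (n - 1) ≤ ∑ b, 2 * δ b,
          ∑ pf : J → Fin n, ((∏ j, ((2 * δ (pf j) : ℕ) : ℝ)) / ((∑ a, 2 * δ a : ℕ) : ℝ) ^ J.card) *
            ∑ a, (Real.exp 3 * κ) ^ (2 * δ a) * ν (δ a) (univ.filter fun j : J => pf j = a).card *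
              ∏ b ∈ univ.erase a, (Real.exp 3 * κ) ^ (2 * δ b) * μ (δ b) (univ.filter fun j : J => pf j = b).card := by
        rw [sum_comm, mul_sum]
        refine sum_congr rfl fun δ _ => ?_
        rw [sum_congr rfl fun a _ => by rw [hGmix a δ]]
        -- exchange the odd slot and the landing profile
        simp only [mul_sum]
        refine sum_comm.trans ?_
        exact sum_congr rfl fun pf _ => sum_congr rfl fun a _ => by ring
    _ = _ := by
        rw [hc, ← Nat.mul_factorial_pred (Nat.pos_iff_ne_zero.1 hn), Nat.cast_mul]
        ring

end Polarised

end Literature.MathematicalPhysics.QuantumLattice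

end
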